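import Summits.BirchSwinnertonDyer.Rank1Residual.JET.CarrierReadingRecordsKitThree
import HarnessLib

/-!
# BSD rank-≤1 residual cell, lane class X4 (ADDITIVE at `3`, `ρ̄_{E,3}` onto), BOTH ranks, Tamagawa-OBSTRUCTED with ONE carrier prime `q ≠ 3`:
# `BSD(E,3)` PER CELL through the JET lane's R-IDX kit doors `JET.bsdp_of_jetRowA3F_tam_min` / `_tamX_min` (ANY reduction at `3`, `3`-adic
# tower by ONE Frobenius witness mod `9`; READING binder K1) on a two-engine HEEGNER-INDEX line in a DEEP field — records 01 (x11c GEN 36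
# «J1-REMAINDER / KOLY-R»)

HONEST FRAMING (cell `b2b-bsdres-*`, verbatim): prove what is provable now; shrink each hard class to its core with data; no claim beyond
stated classes; COMBINATION classes deleted from PUBLISHED theorems only, CONSTRUCTION-shaped remainder typed; this is not "finishing BSD".
X4 / X11b (and X11 ∧ r = 1 ∧ p = 3) stay CONSTRUCTION-SHAPED; everything here is PER CELL; no lane verdict is changed; NO named fact is
introduced (debt 0) and NO definition; nothing is booked by this file (bookings are referee A's, pub-bsdpct); Cremona's numbers (`r_an`,
`#Ш_an`, models, generators, `∏ c_ℓ`, torsion, optimality / Manin codes, the galrep datum) and the Kurihara lane's per-prime tables are INPUTS.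

Unit `b2b-bsdres-x11c`, GEN 36 (prover-b2b-bsdres-x11c-g36-0), move «J1-REMAINDER / KOLY-R». POPULATION (`HOME/b2b-bsdres-x11c/gen36/pop/`:
`census36.py` over referee A's ROUND 983 state of record × the Kurihara lane's sweep records × Cremona, then `build_pop36.py`): EVERY live
residue cell on the Kolyvagin / Jetchev road classes (X4, X7, X8, X11a, X11b), BOTH ranks, odd `p`, whose shape is KOLY (`ρ̄_{E,p}` onto,
`p ∤ #E(ℚ)_tors·∏c·#Ш_an`: 30 cells) or J1 (onto, `p ∤ #E(ℚ)_tors·#Ш_an`, exactly ONE prime `q ∣ N` with `p ∣ c_q`: 171 cells; the two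
J1 cells whose carrier is an ADDITIVE `p` have no door and are excluded) — 199 cells on 191 classes (188 of them with this cell as their ONLY
open cell): 82 rank-one `(3, X11b)`, 59 `(5, X4)` + 2 `(7, X4)` (rank one 19 / rank zero 42), 26 `(3, X4)` J1 (1 / 25), 20 `(3, X4)` KOLY
(6 / 14), 10 KOLY at `p ≥ 5`. The lane never certified them: at rank one its Heegner fields (`|D| ≤ 1511`) read `ord_p [E(K):ℤy_K] = w + 1`
or found no admissible field; at rank zero (additive `p`) no Heegner-index line was ever run. THIS UNIT ran the cell's engines VERBATIM in
DEEPER fields: engine 1 = gen 3 `engine1_cha1b/main.py` = x9-g7 `jobD1b.py` (cypari2, sha256 `69e29ec7…`; rank-one mode: Cremona's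
generator, `hy = L'(E,1)·L(E^D,1)·√|D|/(4·Area)`, `m = √(4·hy/ĥ(P))`; rank-zero mode: the rank-one twist `F = E^D`, a point `x ∈ F(ℚ)` by
`ellrank`, saturated, `hy = L(E,1)·L'(F,1)·√|D|/(4·Area)`, `m = √(4·hy/ĥ(x))` — Miller 2011 Thm. 4.1 / Cor. 4.8; `NDISC 16`, `DBOUND 6000`);
engine 2 = gen 3 `run_cert.py` (`1b54bb20…`) + `e2lib.py` + `tate_stdlib.py` (stdlib re-implementation: `m`, `ord_p m` must be EQUAL,
discrete checks); twist values = additive-p1 `twistvals/main.py` (`e501b988…`). Kit jobs: see HOME/b2b-bsdres-x11c/gen36/harvest/JOBS-gen36.txt. Evidence `HOME/b2b-bsdres-x11c/gen36/`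
(POP36.md, ROWS36-TABLE.md, harvest outputs with inputs.sha256, SHA256SUMS); REPORT.md §45.

THE ROAD (cell `bsd-jet`'s R-IDX grammar, the doors referee A priced at pub-bsdpct ROUNDS 409 / 516 / 600 and booked this unit's
JDEEP rows on at ROUND 890): Jetchev 2008 Thm. 1.4 / Cor. 1.5 READ at the ONE Tamagawa carrier — READING binder K1
`JET.JetchevDivisibilityCarrierNe` (p459625; carrier `q ≠ p`) or K3 `JET.JetchevDivisibilityCarrierMult` (p463660; carrier `q = p` split
multiplicative), both `@[conjecture]` typed readings CONSUMED AS HYPOTHESES (nothing about K1 / K3 is asserted here) — + McCallum 1991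
Cor. 5.6 (`hMcU`), GZK (`hGZK`), Kolyvagin / Gross–Zagier bookkeeping (`hKo`, `hrec`, `hD36`, `hlev`): with `w = ord_p c_q` at the carrier
and a Heegner field `K` in which `ord_p [E(K):ℤy_K] ≤ w`, `Ш(E/ℚ)[p] = 0`, and with `ord_p #Ш_an = 0`, Miller's `BSD(E,p)`.
IN THE KERNEL per cell (`decide` / `norm_num` goals of ONE kit application): the literal Cremona model (`Δ ≠ 0`; global minimality by the
factored Kraus criterion `Supersingular.isGloballyMinimal_of_krausCriterion₃_factored` on the COMPLETE factorisation of `|Δ|`); `ρ̄_{E,p}`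
ONTO (Serre 1972: three Prop-19 witnesses at `p ≥ 5` / an irreducible Frobenius + a Frobenius of order `3` at `p = 3`; the `p`-adic tower
inside the door: Serre IV-23 at `p ≥ 5`, the Tate line at a multiplicative `3`, ONE Frobenius witness mod `9` otherwise); at a
multiplicative `3`: `3 ∣ Δ`, `3 ∤ c₄`; the carrier's Tamagawa number from ONE `TamLocal` (split `I_n`) or exact `TamX` (`IV` / `IV*`)
certificate (n1011-p03's bridges `Additive.IntModelTam.localTamagawaNumber_padic_eq_of_intModel_of_tamLocal` / `_of_tamX`) and
`w ≤ ord_p c_q`. DISPLAYED (hypotheses of every record): `hJ` (READING), `hMcU`, `hGZK`, `hKo`, `hrec`, `hD36`, `hlev`; the Heegner datum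
(`K` imaginary quadratic, `d_K ∉ {−3, −4}`, Heegner hypothesis for the level `N`, `P` a Heegner point of infinite order), bucket A: `q ∣ N`;
the INDEX LINE `hv : ord_p [E(K):ℤP] ≤ w` — THIS UNIT's two-engine deep-field datum, quoted per docstring, NOT re-computed here —;
`hr : r_an ≤ 1`; `hs` / `hvs` : `#Ш_an` a `p`-adic unit (Cremona; exact at rank 0).
What a record is worth is the referee's call (EVIDENCE-grade certificate under displayed binders, as every Heegner-index record of the
cell). Cells in this file: `488070ek1`@3, `169074c1`@3, `271512f1`@3, `281214t1`@3, `302616a1`@3, `339966y1`@3, `385362l1`@3.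

References: D. Jetchev, Compos. Math. 144 (2008) Thm. 1.4, Cor. 1.5 [Jetchev2008]; W. McCallum, LMS LN 153 (1991) §1, Cor. 5.6
[McCallumLMS1991]; B. H. Gross, LMS LN 153 (1991) Prop. 2.1 [GrossLMS1991]; V. A. Kolyvagin (1990) [KolyvaginEulerSystems1990];
J.-P. Serre, Invent. Math. 15 (1972) §2.4 Prop. 15, §2.8 Prop. 19 [Serre1972]; J.-P. Serre, *Abelian ℓ-adic representations* IV-23
[SerreAbelianLadic1968]; B. H. Gross, D. Zagier, Invent. Math. 84 (1986) [GrossZagier1986]; R. L. Miller, LMS J. Comput. Math. 14 (2011)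
Thm. 4.1, Cor. 4.8, Def. 1.1 [Miller2011LMS]; C. Wuthrich, Doc. Math. 19 (2014) Lemma 20 [Wuthrich2014]; J. H. Silverman, *AEC* (2009)
VII.1, VII.5 [SilvermanAEC2009], *ATAEC* (1994) IV.9.4 [SilvermanATAEC1994]; A. Kraus, Acta Arith. 54 (1989) [Kraus1989]; Cremona's
tables [Cremona2006].
-/

set_option autoImplicit false

noncomputable section

open scoped Classical

open WeierstrassCurve Literature.NumberTheory.EllipticCurves
  Literature.NumberTheory.EllipticCurves.ModularForms
  Literature.NumberTheory.EllipticCurves.Rank1Residual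
  Literature.NumberTheory.EllipticCurves.Rank1Residual.Typed
  Literature.NumberTheory.EllipticCurves.Rank1Residual.X11RankOneCertificates
  Summit.BirchSwinnertonDyer.BirchSwinnertonDyer.Rank1Residual
  Summit.BirchSwinnertonDyer.BirchSwinnertonDyer.Rank1Residual.IntModel
  Summit.BirchSwinnertonDyer.BirchSwinnertonDyer.Rank1Residual.X11RankOne
  Summit.BirchSwinnertonDyer.BirchSwinnertonDyer.Rank2Observatory.Tam
  Summit.BirchSwinnertonDyer.Rank1Residual.JET

namespace Summit.BirchSwinnertonDyer.Rank1Residual.X4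

/-- **`BSD(E,3)` for `488070ek1`** (cell `(488070ek1, 3)`, class X4, rank 1; JET grammar key `JETA:488070ek1@3`, bucket A at `p = 3`, `E` additive
at `3` (door `JET.bsdp_of_jetRowA3F_tam_min`, `3`-adic tower by a Frobenius witness mod `9`)); `N = 488070 = 2·3^2·5·11·17·29`, additive `I1*` at
`3`, `r_an = 1`, `#E(ℚ)_tors = 2`, `∏c = 2688`, `#Ш_an = 1`, Cremona galrep: no code at this prime (`ρ̄_{E,3}` onto); `|Δ| = ∏` over `[(2, 14), (3,
7), (5, 4), (11, 1), (17, 6), (29, 2)]` (factored Kraus criterion, every disjunct decided). The ONE carrier: carrier `q = 17` (split `I6`, `c_q =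
6`, `w = ord_3 c_q = 1`; IN THE KERNEL by the `TamLocal` certificate `⟨17, 4, 1, 4, 0, 0, 0, 6, 0, 0, 6⟩`); READING binder `hJ` = K1
`JetchevDivisibilityCarrierNe`; displayed index line `hv : ord_3 [E(K):ℤP] ≤ 1`. Serre Prop-15 witnesses mod `3`: `(ℓ, #Ẽ(𝔽_ℓ))` = `(13, 14)` (`X² −
aX + ℓ` root-free over `𝔽₃`), `(127, 120)` (`ℓ ≡ 1`, `a ≡ 2 (mod 3)`, `9 ∤ #Ẽ`); `3`-adic tower witness `(ℓ₉, #Ẽ) = (41, 36)` (`ℓ₉ ≡ 5 (mod 9)`,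
`a_ℓ₉ ≡ 6 (mod 9)`). Kurihara lane note of record: «additive p, r=1». State of record (referee A ROUND 983,
`scratchA_A_state_after_x4gh_add3_onA2R977_fold.pkl`): class `residue`, 6 open cell(s), register empty. FLAG `opt-code-2` (Cremona optimality code
2; `ρ̄_{E,3}` onto forbids a `3`-isogeny in the class, so `ord_3` of the index is class-invariant; the reading stands if the optimal curve's Manin
constant is prime to `3`). Other engine-1 fields tried (`D`: `m` (`ord_3 m`)): none. THIS UNIT'S DATUM (displayed, NOT re-computed here): DEEP FIELD
`K = ℚ(√-5279)` (`5279` = prime): **`m = [E(K):ℤy_K] = 5376`, `ord_3 m = 1`** (`ρ = m²/4`, `L'(E,1) = 15.714192097`, `L(E^D,1) = 18.619665619`,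
`ĥ(P) = 0.2271242531`; Cremona's generator) — engine 1 j293228 = engine 2 j293889: `m = 5376` EQUAL (FAIL:p2_not_div_N, dev ≤ 1.8e-14); twist `E^D`
(j293892): `N = 13601457156870`, `#tors·∏c·#Ш_an = 2·10752·4`, `ord_3 #Ш_an(E^D) = 0`, `ord_3 ∏c(E^D) = 1` (BSD-consistent). CONDITIONAL on every
binder; per cell; nothing booked by this file.
[cite: Jetchev2008, Thm. 1.4 and Cor. 1.5 (p. 812)] [cite: McCallumLMS1991, Cor. 5.6] [cite: Serre1972, §2.4 Prop. 15, §2.8 Prop. 19] [cite: Cremona2006, Table 1 (label 488070ek1)] -/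
theorem bsdpJD_488070ek1_3
    (hJ : JetchevDivisibilityCarrierNe)
    (hMcU : McCallum1991_padicValNat_card_sha_primary_add_le_of_globalDivisibility)
    (hGZK : rank_eq_analyticRank_of_analyticRank_le_one)
    (hKo : ∀ (N : ℕ) [NeZero N] (W : WeierstrassCurve ℚ) (K : Type) [Field K] [NumberField K], kolyvagin N W K)
    (hrec : ∀ (N : ℕ) [NeZero N] (W : WeierstrassCurve ℚ) (K : Type) [Field K] [NumberField K],
      heegnerPointOfConductor_one_galoisConj N W K)
    (hD36 : ∀ (N : ℕ) [NeZero N] (W : WeierstrassCurve ℚ) (K : Type) [Field K] [NumberField K],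
      phi_heegnerTau_mem_singularModuliField N W K)
    (hlev : ∀ {N : ℕ} [NeZero N], IsNewformOf.level_eq_conductorNorm (N := N))
    (W : WeierstrassCurve ℚ) (hW : W = ⟨1, -1, 1, -5138897, -2919226431⟩)
    {N : ℕ} [NeZero N] {K : Type} [Field K] [NumberField K] (hK : IsImaginaryQuadratic K)
    (hD3 : NumberField.discr K ≠ -3) (hD4 : NumberField.discr K ≠ -4)
    (hH : SatisfiesHeegnerHypothesis N K) {P : (W.baseChange K).toAffine.Point}
    (hP : IsHeegnerPoint N W K P) (hnt : ¬ IsOfFinAddOrder P) (hqN : 17 ∣ N)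
    (hv : padicValNat 3 (AddSubgroup.zmultiples P).index ≤ 1)
    (hr : W.analyticRank ≤ 1) {s : ℚ} (hs : shaAn W = (s : ℂ)) (hvs : padicValRat 3 s = 0) : BSDp W 3 :=
  bsdp_of_jetRowA3F_tam_min 1 (-1) 1 (-5138897) (-2919226431)
    (Supersingular.isGloballyMinimal_of_krausCriterion₃_factored 1 (-1) 1 (-5138897) (-2919226431) [(2, 14), (3, 7), (5, 4), (11, 1), (17, 6), (29, 2)] (by decide +kernel)
      (by intro t ht; fin_cases ht <;> norm_num) (by decide +kernel))
    13 127 (by norm_num) (by norm_num) (by decide) (by decide) (by decide) (by decide) (by decide +kernel) (by decide +kernel)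
    (n₁ := 14) (n₂ := 120) (by decide +kernel) (by decide +kernel) (by decide) (by decide) (by decide) (by decide)
    41 (by norm_num) (by decide) (by decide +kernel) (n₉ := 36) (by decide +kernel) (by decide) (by decide)
    17 ⟨17, 4, 1, 4, 0, 0, 0, 6, 0, 0, 6⟩ rfl (by decide +kernel) (c := 6) (by decide +kernel) (w := 1) (by decide +kernel) (by decide)
    hJ hMcU hGZK hKo hrec hD36 hlev W hW hK hD3 hD4 hH hP hnt hqN hv hr hs hvs

/-- **`BSD(E,3)` for `169074c1`** (cell `(169074c1, 3)`, class X4, rank 0; JET grammar key `JETA:169074c1@3`, bucket A at `p = 3`, `E` additive at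
`3` (door `JET.bsdp_of_jetRowA3F_tam_min`, `3`-adic tower by a Frobenius witness mod `9`)); `N = 169074 = 2·3^3·31·101`, additive `II*` at `3`,
`r_an = 0`, `#E(ℚ)_tors = 1`, `∏c = 72`, `#Ш_an = 4`, Cremona galrep: no code at this prime (`ρ̄_{E,3}` onto); `|Δ| = ∏` over `[(2, 72), (3, 11),
(31, 3), (101, 1)]` (factored Kraus criterion, every disjunct decided). The ONE carrier: carrier `q = 2` (split `I72`, `c_q = 72`, `w = ord_3 c_q =
2`; IN THE KERNEL by the `TamLocal` certificate `⟨2, 1, 1, 0, 0, 0, 0, 72, 0, 0, 72⟩`); READING binder `hJ` = K1 `JetchevDivisibilityCarrierNe`;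
displayed index line `hv : ord_3 [E(K):ℤP] ≤ 2`. Serre Prop-15 witnesses mod `3`: `(ℓ, #Ẽ(𝔽_ℓ))` = `(7, 5)` (`X² − aX + ℓ` root-free over `𝔽₃`),
`(97, 111)` (`ℓ ≡ 1`, `a ≡ 2 (mod 3)`, `9 ∤ #Ẽ`); `3`-adic tower witness `(ℓ₉, #Ẽ) = (41, 48)` (`ℓ₉ ≡ 5 (mod 9)`, `a_ℓ₉ ≡ 3 (mod 9)`). Kurihara lane
note of record: «additive p, irreducible». State of record (referee A ROUND 983, `scratchA_A_state_after_x4gh_add3_onA2R977_fold.pkl`): class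
`residue`, 1 open cell(s), register empty. Other engine-1 fields tried (`D`: `m` (`ord_3 m`)): none. THIS UNIT'S DATUM (displayed, NOT re-computed
here): DEEP FIELD `K = ℚ(√-1703)` (`1703` = 13·131): rank-one twist `F = E^D` (`N_F = 490349936466`), point `x` on `F` by ellrank0 (saturated at the
primes `< 100`), **`m = [E(K):ℤy_K] = 2880`, `ord_3 m = 2`** (`ρ = m²/4`, `L(E,1) = 3.7220106322`, `L'(F,1) = 12.738813914`, `ĥ(x) = 6.3380078383`)
— engine 1 j293243 = engine 2 j295405: `m = 2880` EQUAL (FAIL:p2_not_div_N, dev ≤ 2.1e-14); twist `E^D` (j293857): `N = 490349936466`,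
`#tors·∏c·#Ш_an = 1·576·25`, `ord_3 #Ш_an(E^D) = 0`, `ord_3 ∏c(E^D) = 2` (BSD-consistent). CONDITIONAL on every binder; per cell; nothing booked by
this file.
[cite: Jetchev2008, Thm. 1.4 and Cor. 1.5 (p. 812)] [cite: McCallumLMS1991, Cor. 5.6] [cite: Serre1972, §2.4 Prop. 15, §2.8 Prop. 19] [cite: Cremona2006, Table 1 (label 169074c1)] -/
theorem bsdpJD_169074c1_3
    (hJ : JetchevDivisibilityCarrierNe)
    (hMcU : McCallum1991_padicValNat_card_sha_primary_add_le_of_globalDivisibility)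
    (hGZK : rank_eq_analyticRank_of_analyticRank_le_one)
    (hKo : ∀ (N : ℕ) [NeZero N] (W : WeierstrassCurve ℚ) (K : Type) [Field K] [NumberField K], kolyvagin N W K)
    (hrec : ∀ (N : ℕ) [NeZero N] (W : WeierstrassCurve ℚ) (K : Type) [Field K] [NumberField K],
      heegnerPointOfConductor_one_galoisConj N W K)
    (hD36 : ∀ (N : ℕ) [NeZero N] (W : WeierstrassCurve ℚ) (K : Type) [Field K] [NumberField K],
      phi_heegnerTau_mem_singularModuliField N W K)
    (hlev : ∀ {N : ℕ} [NeZero N], IsNewformOf.level_eq_conductorNorm (N := N))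
    (W : WeierstrassCurve ℚ) (hW : W = ⟨1, -1, 1, -23397668345, 2779260058098073⟩)
    {N : ℕ} [NeZero N] {K : Type} [Field K] [NumberField K] (hK : IsImaginaryQuadratic K)
    (hD3 : NumberField.discr K ≠ -3) (hD4 : NumberField.discr K ≠ -4)
    (hH : SatisfiesHeegnerHypothesis N K) {P : (W.baseChange K).toAffine.Point}
    (hP : IsHeegnerPoint N W K P) (hnt : ¬ IsOfFinAddOrder P) (hqN : 2 ∣ N)
    (hv : padicValNat 3 (AddSubgroup.zmultiples P).index ≤ 2)
    (hr : W.analyticRank ≤ 1) {s : ℚ} (hs : shaAn W = (s : ℂ)) (hvs : padicValRat 3 s = 0) : BSDp W 3 :=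
  bsdp_of_jetRowA3F_tam_min 1 (-1) 1 (-23397668345) 2779260058098073
    (Supersingular.isGloballyMinimal_of_krausCriterion₃_factored 1 (-1) 1 (-23397668345) 2779260058098073 [(2, 72), (3, 11), (31, 3), (101, 1)] (by decide +kernel)
      (by intro t ht; fin_cases ht <;> norm_num) (by decide +kernel))
    7 97 (by norm_num) (by norm_num) (by decide) (by decide) (by decide) (by decide) (by decide +kernel) (by decide +kernel)
    (n₁ := 5) (n₂ := 111) (by decide +kernel) (by decide +kernel) (by decide) (by decide) (by decide) (by decide)
    41 (by norm_num) (by decide) (by decide +kernel) (n₉ := 48) (by decide +kernel) (by decide) (by decide)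
    2 ⟨2, 1, 1, 0, 0, 0, 0, 72, 0, 0, 72⟩ rfl (by decide +kernel) (c := 72) (by decide +kernel) (w := 2) (by decide +kernel) (by decide)
    hJ hMcU hGZK hKo hrec hD36 hlev W hW hK hD3 hD4 hH hP hnt hqN hv hr hs hvs

/-- **`BSD(E,3)` for `271512f1`** (cell `(271512f1, 3)`, class X4, rank 0; JET grammar key `JETA:271512f1@3`, bucket A at `p = 3`, `E` additive at
`3` (door `JET.bsdp_of_jetRowA3F_tam_min`, `3`-adic tower by a Frobenius witness mod `9`)); `N = 271512 = 2^3·3^4·419`, additive `II` at `3`, `r_an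
= 0`, `#E(ℚ)_tors = 1`, `∏c = 6`, `#Ш_an = 1`, Cremona galrep: no code at this prime (`ρ̄_{E,3}` onto); `|Δ| = ∏` over `[(2, 4), (3, 4), (419, 3)]`
(factored Kraus criterion, every disjunct decided). The ONE carrier: carrier `q = 419` (split `I3`, `c_q = 3`, `w = ord_3 c_q = 1`; IN THE KERNEL by
the `TamLocal` certificate `⟨419, 20, 1, 54, 0, 0, 0, 3, 0, 0, 3⟩`); READING binder `hJ` = K1 `JetchevDivisibilityCarrierNe`; displayed index line
`hv : ord_3 [E(K):ℤP] ≤ 1`. Serre Prop-15 witnesses mod `3`: `(ℓ, #Ẽ(𝔽_ℓ))` = `(5, 4)` (`X² − aX + ℓ` root-free over `𝔽₃`), `(19, 12)` (`ℓ ≡ 1`, `a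
≡ 2 (mod 3)`, `9 ∤ #Ẽ`); `3`-adic tower witness `(ℓ₉, #Ẽ) = (29, 27)` (`ℓ₉ ≡ 2 (mod 9)`, `a_ℓ₉ ≡ 3 (mod 9)`). Kurihara lane note of record:
«additive p, irreducible». State of record (referee A ROUND 983, `scratchA_A_state_after_x4gh_add3_onA2R977_fold.pkl`): class `residue`, 1 open
cell(s), register empty. Other engine-1 fields tried (`D`: `m` (`ord_3 m`)): `-71`: `m = 36` (`ord = 2`); `-143`: `m = 24` (`ord = 1`); `-239`: `m =
12` (`ord = 1`); `-263`: `m = 12` (`ord = 1`); `-335`: `m = 24` (`ord = 1`); `-407`: `m = 24` (`ord = 1`). THIS UNIT'S DATUM (displayed, NOT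
re-computed here): DEEP FIELD `K = ℚ(√-95)` (`95` = 5·19): rank-one twist `F = E^D` (`N_F = 2450395800`), point `x` on `F` by ellrank0 (saturated at
the primes `< 100`), **`m = [E(K):ℤy_K] = 24`, `ord_3 m = 1`** (`ρ = m²/4`, `L(E,1) = 5.9070517684`, `L'(F,1) = 14.142628034`, `ĥ(x) =
7.0990991682`) — engine 1 j293245 = engine 2 j295406: `m = 24` EQUAL (FAIL:p2_not_div_N, dev ≤ 1.1e-14); twist `E^D` (j293857): `N = 2450395800`,
`#tors·∏c·#Ш_an = 1·48·1`, `ord_3 #Ш_an(E^D) = 0`, `ord_3 ∏c(E^D) = 1` (BSD-consistent). CONDITIONAL on every binder; per cell; nothing booked by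
this file.
[cite: Jetchev2008, Thm. 1.4 and Cor. 1.5 (p. 812)] [cite: McCallumLMS1991, Cor. 5.6] [cite: Serre1972, §2.4 Prop. 15, §2.8 Prop. 19] [cite: Cremona2006, Table 1 (label 271512f1)] -/
theorem bsdpJD_271512f1_3
    (hJ : JetchevDivisibilityCarrierNe)
    (hMcU : McCallum1991_padicValNat_card_sha_primary_add_le_of_globalDivisibility)
    (hGZK : rank_eq_analyticRank_of_analyticRank_le_one)
    (hKo : ∀ (N : ℕ) [NeZero N] (W : WeierstrassCurve ℚ) (K : Type) [Field K] [NumberField K], kolyvagin N W K)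
    (hrec : ∀ (N : ℕ) [NeZero N] (W : WeierstrassCurve ℚ) (K : Type) [Field K] [NumberField K],
      heegnerPointOfConductor_one_galoisConj N W K)
    (hD36 : ∀ (N : ℕ) [NeZero N] (W : WeierstrassCurve ℚ) (K : Type) [Field K] [NumberField K],
      phi_heegnerTau_mem_singularModuliField N W K)
    (hlev : ∀ {N : ℕ} [NeZero N], IsNewformOf.level_eq_conductorNorm (N := N))
    (W : WeierstrassCurve ℚ) (hW : W = ⟨0, 0, 0, -1074, 20105⟩)
    {N : ℕ} [NeZero N] {K : Type} [Field K] [NumberField K] (hK : IsImaginaryQuadratic K)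
    (hD3 : NumberField.discr K ≠ -3) (hD4 : NumberField.discr K ≠ -4)
    (hH : SatisfiesHeegnerHypothesis N K) {P : (W.baseChange K).toAffine.Point}
    (hP : IsHeegnerPoint N W K P) (hnt : ¬ IsOfFinAddOrder P) (hqN : 419 ∣ N)
    (hv : padicValNat 3 (AddSubgroup.zmultiples P).index ≤ 1)
    (hr : W.analyticRank ≤ 1) {s : ℚ} (hs : shaAn W = (s : ℂ)) (hvs : padicValRat 3 s = 0) : BSDp W 3 :=
  bsdp_of_jetRowA3F_tam_min 0 0 0 (-1074) 20105
    (Supersingular.isGloballyMinimal_of_krausCriterion₃_factored 0 0 0 (-1074) 20105 [(2, 4), (3, 4), (419, 3)] (by decide +kernel)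
      (by intro t ht; fin_cases ht <;> norm_num) (by decide +kernel))
    5 19 (by norm_num) (by norm_num) (by decide) (by decide) (by decide) (by decide) (by decide +kernel) (by decide +kernel)
    (n₁ := 4) (n₂ := 12) (by decide +kernel) (by decide +kernel) (by decide) (by decide) (by decide) (by decide)
    29 (by norm_num) (by decide) (by decide +kernel) (n₉ := 27) (by decide +kernel) (by decide) (by decide)
    419 ⟨419, 20, 1, 54, 0, 0, 0, 3, 0, 0, 3⟩ rfl (by decide +kernel) (c := 3) (by decide +kernel) (w := 1) (by decide +kernel) (by decide)
    hJ hMcU hGZK hKo hrec hD36 hlev W hW hK hD3 hD4 hH hP hnt hqN hv hr hs hvs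

/-- **`BSD(E,3)` for `281214t1`** (cell `(281214t1, 3)`, class X4, rank 0; JET grammar key `JETA:281214t1@3`, bucket A at `p = 3`, `E` additive at
`3` (door `JET.bsdp_of_jetRowA3F_tam_min`, `3`-adic tower by a Frobenius witness mod `9`)); `N = 281214 = 2·3^2·17·919`, additive `III*` at `3`,
`r_an = 0`, `#E(ℚ)_tors = 1`, `∏c = 126`, `#Ш_an = 1`, Cremona galrep: no code at this prime (`ρ̄_{E,3}` onto); `|Δ| = ∏` over `[(2, 63), (3, 9),
(17, 1), (919, 1)]` (factored Kraus criterion, every disjunct decided). The ONE carrier: carrier `q = 2` (split `I63`, `c_q = 63`, `w = ord_3 c_q =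
2`; IN THE KERNEL by the `TamLocal` certificate `⟨2, 1, 1, 0, 0, 0, 0, 63, 0, 0, 63⟩`); READING binder `hJ` = K1 `JetchevDivisibilityCarrierNe`;
displayed index line `hv : ord_3 [E(K):ℤP] ≤ 2`. Serre Prop-15 witnesses mod `3`: `(ℓ, #Ẽ(𝔽_ℓ))` = `(7, 11)` (`X² − aX + ℓ` root-free over `𝔽₃`),
`(13, 12)` (`ℓ ≡ 1`, `a ≡ 2 (mod 3)`, `9 ∤ #Ẽ`); `3`-adic tower witness `(ℓ₉, #Ẽ) = (41, 54)` (`ℓ₉ ≡ 5 (mod 9)`, `a_ℓ₉ ≡ 6 (mod 9)`). Kurihara lane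
note of record: «additive p, irreducible». State of record (referee A ROUND 983, `scratchA_A_state_after_x4gh_add3_onA2R977_fold.pkl`): class
`residue`, 1 open cell(s), register empty. Other engine-1 fields tried (`D`: `m` (`ord_3 m`)): `-383`: `m = 504` (`ord = 2`); `-455`: `m = 504`
(`ord = 2`); `-599`: `m = 504` (`ord = 2`); `-815`: `m = 504` (`ord = 2`); `-1511`: `m = 252` (`ord = 2`); `-1631`: `m = 252` (`ord = 2`); `-1679`:
`m = 504` (`ord = 2`). THIS UNIT'S DATUM (displayed, NOT re-computed here): DEEP FIELD `K = ℚ(√-239)` (`239` = prime): rank-one twist `F = E^D`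
(`N_F = 16063224894`), point `x` on `F` by ellrank0 (saturated at the primes `< 100`), **`m = [E(K):ℤy_K] = 504`, `ord_3 m = 2`** (`ρ = m²/4`,
`L(E,1) = 3.0216170114`, `L'(F,1) = 46.385003720`, `ĥ(x) = 31.258788291`) — engine 1 j293243 = engine 2 j295406: `m = 504` EQUAL (FAIL:p2_not_div_N,
dev ≤ 2.8e-14); twist `E^D` (j293857): `N = 16063224894`, `#tors·∏c·#Ш_an = 1·504·1`, `ord_3 #Ш_an(E^D) = 0`, `ord_3 ∏c(E^D) = 2` (BSD-consistent).
CONDITIONAL on every binder; per cell; nothing booked by this file.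
[cite: Jetchev2008, Thm. 1.4 and Cor. 1.5 (p. 812)] [cite: McCallumLMS1991, Cor. 5.6] [cite: Serre1972, §2.4 Prop. 15, §2.8 Prop. 19] [cite: Cremona2006, Table 1 (label 281214t1)] -/
theorem bsdpJD_281214t1_3
    (hJ : JetchevDivisibilityCarrierNe)
    (hMcU : McCallum1991_padicValNat_card_sha_primary_add_le_of_globalDivisibility)
    (hGZK : rank_eq_analyticRank_of_analyticRank_le_one)
    (hKo : ∀ (N : ℕ) [NeZero N] (W : WeierstrassCurve ℚ) (K : Type) [Field K] [NumberField K], kolyvagin N W K)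
    (hrec : ∀ (N : ℕ) [NeZero N] (W : WeierstrassCurve ℚ) (K : Type) [Field K] [NumberField K],
      heegnerPointOfConductor_one_galoisConj N W K)
    (hD36 : ∀ (N : ℕ) [NeZero N] (W : WeierstrassCurve ℚ) (K : Type) [Field K] [NumberField K],
      phi_heegnerTau_mem_singularModuliField N W K)
    (hlev : ∀ {N : ℕ} [NeZero N], IsNewformOf.level_eq_conductorNorm (N := N))
    (W : WeierstrassCurve ℚ) (hW : W = ⟨1, -1, 1, -1573301720, -23882168437541⟩)
    {N : ℕ} [NeZero N] {K : Type} [Field K] [NumberField K] (hK : IsImaginaryQuadratic K)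
    (hD3 : NumberField.discr K ≠ -3) (hD4 : NumberField.discr K ≠ -4)
    (hH : SatisfiesHeegnerHypothesis N K) {P : (W.baseChange K).toAffine.Point}
    (hP : IsHeegnerPoint N W K P) (hnt : ¬ IsOfFinAddOrder P) (hqN : 2 ∣ N)
    (hv : padicValNat 3 (AddSubgroup.zmultiples P).index ≤ 2)
    (hr : W.analyticRank ≤ 1) {s : ℚ} (hs : shaAn W = (s : ℂ)) (hvs : padicValRat 3 s = 0) : BSDp W 3 :=
  bsdp_of_jetRowA3F_tam_min 1 (-1) 1 (-1573301720) (-23882168437541)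
    (Supersingular.isGloballyMinimal_of_krausCriterion₃_factored 1 (-1) 1 (-1573301720) (-23882168437541) [(2, 63), (3, 9), (17, 1), (919, 1)] (by decide +kernel)
      (by intro t ht; fin_cases ht <;> norm_num) (by decide +kernel))
    7 13 (by norm_num) (by norm_num) (by decide) (by decide) (by decide) (by decide) (by decide +kernel) (by decide +kernel)
    (n₁ := 11) (n₂ := 12) (by decide +kernel) (by decide +kernel) (by decide) (by decide) (by decide) (by decide)
    41 (by norm_num) (by decide) (by decide +kernel) (n₉ := 54) (by decide +kernel) (by decide) (by decide)
    2 ⟨2, 1, 1, 0, 0, 0, 0, 63, 0, 0, 63⟩ rfl (by decide +kernel) (c := 63) (by decide +kernel) (w := 2) (by decide +kernel) (by decide)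
    hJ hMcU hGZK hKo hrec hD36 hlev W hW hK hD3 hD4 hH hP hnt hqN hv hr hs hvs

/-- **`BSD(E,3)` for `302616a1`** (cell `(302616a1, 3)`, class X4, rank 0; JET grammar key `JETA:302616a1@3`, bucket A at `p = 3`, `E` additive at
`3` (door `JET.bsdp_of_jetRowA3F_tam_min`, `3`-adic tower by a Frobenius witness mod `9`)); `N = 302616 = 2^3·3^4·467`, additive `II` at `3`, `r_an
= 0`, `#E(ℚ)_tors = 1`, `∏c = 6`, `#Ш_an = 1`, Cremona galrep: no code at this prime (`ρ̄_{E,3}` onto); `|Δ| = ∏` over `[(2, 4), (3, 4), (467, 3)]`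
(factored Kraus criterion, every disjunct decided). The ONE carrier: carrier `q = 467` (split `I3`, `c_q = 3`, `w = ord_3 c_q = 1`; IN THE KERNEL by
the `TamLocal` certificate `⟨467, 21, 1, 195, 0, 0, 0, 3, 0, 0, 3⟩`); READING binder `hJ` = K1 `JetchevDivisibilityCarrierNe`; displayed index line
`hv : ord_3 [E(K):ℤP] ≤ 1`. Serre Prop-15 witnesses mod `3`: `(ℓ, #Ẽ(𝔽_ℓ))` = `(5, 10)` (`X² − aX + ℓ` root-free over `𝔽₃`), `(31, 30)` (`ℓ ≡ 1`, `a
≡ 2 (mod 3)`, `9 ∤ #Ẽ`); `3`-adic tower witness `(ℓ₉, #Ẽ) = (41, 36)` (`ℓ₉ ≡ 5 (mod 9)`, `a_ℓ₉ ≡ 6 (mod 9)`). Kurihara lane note of record: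
«additive p, irreducible». State of record (referee A ROUND 983, `scratchA_A_state_after_x4gh_add3_onA2R977_fold.pkl`): class `residue`, 1 open
cell(s), register empty. Other engine-1 fields tried (`D`: `m` (`ord_3 m`)): `-167`: `m = 12` (`ord = 1`); `-191`: `m = 12` (`ord = 1`); `-311`: `m
= 12` (`ord = 1`); `-359`: `m = 12` (`ord = 1`); `-431`: `m = 12` (`ord = 1`); `-455`: `m = 12` (`ord = 1`); `-527`: `m = 24` (`ord = 1`); `-695`:
`m = 24` (`ord = 1`); `-815`: `m = 12` (`ord = 1`); `-839`: `m = 12` (`ord = 1`). THIS UNIT'S DATUM (displayed, NOT re-computed here): DEEP FIELD `K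
= ℚ(√-143)` (`143` = 11·13): rank-one twist `F = E^D` (`N_F = 6188194584`), point `x` on `F` by ellrank0 (saturated at the primes `< 100`), **`m =
[E(K):ℤy_K] = 12`, `ord_3 m = 1`** (`ρ = m²/4`, `L(E,1) = 1.0652284624`, `L'(F,1) = 35.947485160`, `ĥ(x) = 36.872608745`) — engine 1 j293245 =
engine 2 j293855: `m = 12` EQUAL (FAIL:p2_not_div_N, dev ≤ 4.6e-14); twist `E^D` (j293857): `N = 6188194584`, `#tors·∏c·#Ш_an = 1·12·1`, `ord_3
#Ш_an(E^D) = 0`, `ord_3 ∏c(E^D) = 1` (BSD-consistent). CONDITIONAL on every binder; per cell; nothing booked by this file.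
[cite: Jetchev2008, Thm. 1.4 and Cor. 1.5 (p. 812)] [cite: McCallumLMS1991, Cor. 5.6] [cite: Serre1972, §2.4 Prop. 15, §2.8 Prop. 19] [cite: Cremona2006, Table 1 (label 302616a1)] -/
theorem bsdpJD_302616a1_3
    (hJ : JetchevDivisibilityCarrierNe)
    (hMcU : McCallum1991_padicValNat_card_sha_primary_add_le_of_globalDivisibility)
    (hGZK : rank_eq_analyticRank_of_analyticRank_le_one)
    (hKo : ∀ (N : ℕ) [NeZero N] (W : WeierstrassCurve ℚ) (K : Type) [Field K] [NumberField K], kolyvagin N W K)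
    (hrec : ∀ (N : ℕ) [NeZero N] (W : WeierstrassCurve ℚ) (K : Type) [Field K] [NumberField K],
      heegnerPointOfConductor_one_galoisConj N W K)
    (hD36 : ∀ (N : ℕ) [NeZero N] (W : WeierstrassCurve ℚ) (K : Type) [Field K] [NumberField K],
      phi_heegnerTau_mem_singularModuliField N W K)
    (hlev : ∀ {N : ℕ} [NeZero N], IsNewformOf.level_eq_conductorNorm (N := N))
    (W : WeierstrassCurve ℚ) (hW : W = ⟨0, 0, 0, -32682, -2274175⟩)
    {N : ℕ} [NeZero N] {K : Type} [Field K] [NumberField K] (hK : IsImaginaryQuadratic K)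
    (hD3 : NumberField.discr K ≠ -3) (hD4 : NumberField.discr K ≠ -4)
    (hH : SatisfiesHeegnerHypothesis N K) {P : (W.baseChange K).toAffine.Point}
    (hP : IsHeegnerPoint N W K P) (hnt : ¬ IsOfFinAddOrder P) (hqN : 467 ∣ N)
    (hv : padicValNat 3 (AddSubgroup.zmultiples P).index ≤ 1)
    (hr : W.analyticRank ≤ 1) {s : ℚ} (hs : shaAn W = (s : ℂ)) (hvs : padicValRat 3 s = 0) : BSDp W 3 :=
  bsdp_of_jetRowA3F_tam_min 0 0 0 (-32682) (-2274175)
    (Supersingular.isGloballyMinimal_of_krausCriterion₃_factored 0 0 0 (-32682) (-2274175) [(2, 4), (3, 4), (467, 3)] (by decide +kernel)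
      (by intro t ht; fin_cases ht <;> norm_num) (by decide +kernel))
    5 31 (by norm_num) (by norm_num) (by decide) (by decide) (by decide) (by decide) (by decide +kernel) (by decide +kernel)
    (n₁ := 10) (n₂ := 30) (by decide +kernel) (by decide +kernel) (by decide) (by decide) (by decide) (by decide)
    41 (by norm_num) (by decide) (by decide +kernel) (n₉ := 36) (by decide +kernel) (by decide) (by decide)
    467 ⟨467, 21, 1, 195, 0, 0, 0, 3, 0, 0, 3⟩ rfl (by decide +kernel) (c := 3) (by decide +kernel) (w := 1) (by decide +kernel) (by decide)
    hJ hMcU hGZK hKo hrec hD36 hlev W hW hK hD3 hD4 hH hP hnt hqN hv hr hs hvs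

/-- **`BSD(E,3)` for `339966y1`** (cell `(339966y1, 3)`, class X4, rank 0; JET grammar key `JETA:339966y1@3`, bucket A at `p = 3`, `E` additive at
`3` (door `JET.bsdp_of_jetRowA3F_tam_min`, `3`-adic tower by a Frobenius witness mod `9`)); `N = 339966 = 2·3^2·11·17·101`, additive `III` at `3`,
`r_an = 0`, `#E(ℚ)_tors = 2`, `∏c = 432`, `#Ш_an = 4`, Cremona galrep: no code at this prime (`ρ̄_{E,3}` onto); `|Δ| = ∏` over `[(2, 54), (3, 3),
(11, 7), (17, 6), (101, 2)]` (factored Kraus criterion, every disjunct decided). The ONE carrier: carrier `q = 2` (split `I54`, `c_q = 54`, `w =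
ord_3 c_q = 3`; IN THE KERNEL by the `TamLocal` certificate `⟨2, 1, 1, 0, 0, 0, 0, 54, 0, 0, 54⟩`); READING binder `hJ` = K1
`JetchevDivisibilityCarrierNe`; displayed index line `hv : ord_3 [E(K):ℤP] ≤ 3`. Serre Prop-15 witnesses mod `3`: `(ℓ, #Ẽ(𝔽_ℓ))` = `(7, 8)` (`X² −
aX + ℓ` root-free over `𝔽₃`), `(19, 24)` (`ℓ ≡ 1`, `a ≡ 2 (mod 3)`, `9 ∤ #Ẽ`); `3`-adic tower witness `(ℓ₉, #Ẽ) = (149, 156)` (`ℓ₉ ≡ 5 (mod 9)`,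
`a_ℓ₉ ≡ 3 (mod 9)`). Kurihara lane note of record: «additive p, irreducible». State of record (referee A ROUND 983,
`scratchA_A_state_after_x4gh_add3_onA2R977_fold.pkl`): class `residue`, 1 open cell(s), register empty. Other engine-1 fields tried (`D`: `m`
(`ord_3 m`)): `-1415`: `m = 864` (`ord = 3`). THIS UNIT'S DATUM (displayed, NOT re-computed here): DEEP FIELD `K = ℚ(√-791)` (`791` = 7·113):
rank-one twist `F = E^D` (`N_F = 212710266846`), point `x` on `F` by ellrank0 (saturated at the primes `< 100`), **`m = [E(K):ℤy_K] = 4320`, `ord_3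
m = 3`** (`ρ = m²/4`, `L(E,1) = 2.2880552127`, `L'(F,1) = 37.053265042`, `ĥ(x) = 12.025783720`) — engine 1 j293245 = engine 2 j295406: `m = 4320`
EQUAL (FAIL:p2_not_div_N, dev ≤ 1.8e-14); twist `E^D` (j293857): `N = 212710266846`, `#tors·∏c·#Ш_an = 2·1728·25`, `ord_3 #Ш_an(E^D) = 0`, `ord_3
∏c(E^D) = 3` (BSD-consistent). CONDITIONAL on every binder; per cell; nothing booked by this file.
[cite: Jetchev2008, Thm. 1.4 and Cor. 1.5 (p. 812)] [cite: McCallumLMS1991, Cor. 5.6] [cite: Serre1972, §2.4 Prop. 15, §2.8 Prop. 19] [cite: Cremona2006, Table 1 (label 339966y1)] -/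
theorem bsdpJD_339966y1_3
    (hJ : JetchevDivisibilityCarrierNe)
    (hMcU : McCallum1991_padicValNat_card_sha_primary_add_le_of_globalDivisibility)
    (hGZK : rank_eq_analyticRank_of_analyticRank_le_one)
    (hKo : ∀ (N : ℕ) [NeZero N] (W : WeierstrassCurve ℚ) (K : Type) [Field K] [NumberField K], kolyvagin N W K)
    (hrec : ∀ (N : ℕ) [NeZero N] (W : WeierstrassCurve ℚ) (K : Type) [Field K] [NumberField K],
      heegnerPointOfConductor_one_galoisConj N W K)
    (hD36 : ∀ (N : ℕ) [NeZero N] (W : WeierstrassCurve ℚ) (K : Type) [Field K] [NumberField K],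
      phi_heegnerTau_mem_singularModuliField N W K)
    (hlev : ∀ {N : ℕ} [NeZero N], IsNewformOf.level_eq_conductorNorm (N := N))
    (W : WeierstrassCurve ℚ) (hW : W = ⟨1, -1, 1, -671835987125, -198802270152659891⟩)
    {N : ℕ} [NeZero N] {K : Type} [Field K] [NumberField K] (hK : IsImaginaryQuadratic K)
    (hD3 : NumberField.discr K ≠ -3) (hD4 : NumberField.discr K ≠ -4)
    (hH : SatisfiesHeegnerHypothesis N K) {P : (W.baseChange K).toAffine.Point}
    (hP : IsHeegnerPoint N W K P) (hnt : ¬ IsOfFinAddOrder P) (hqN : 2 ∣ N)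
    (hv : padicValNat 3 (AddSubgroup.zmultiples P).index ≤ 3)
    (hr : W.analyticRank ≤ 1) {s : ℚ} (hs : shaAn W = (s : ℂ)) (hvs : padicValRat 3 s = 0) : BSDp W 3 :=
  bsdp_of_jetRowA3F_tam_min 1 (-1) 1 (-671835987125) (-198802270152659891)
    (Supersingular.isGloballyMinimal_of_krausCriterion₃_factored 1 (-1) 1 (-671835987125) (-198802270152659891) [(2, 54), (3, 3), (11, 7), (17, 6), (101, 2)] (by decide +kernel)
      (by intro t ht; fin_cases ht <;> norm_num) (by decide +kernel))
    7 19 (by norm_num) (by norm_num) (by decide) (by decide) (by decide) (by decide) (by decide +kernel) (by decide +kernel)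
    (n₁ := 8) (n₂ := 24) (by decide +kernel) (by decide +kernel) (by decide) (by decide) (by decide) (by decide)
    149 (by norm_num) (by decide) (by decide +kernel) (n₉ := 156) (by decide +kernel) (by decide) (by decide)
    2 ⟨2, 1, 1, 0, 0, 0, 0, 54, 0, 0, 54⟩ rfl (by decide +kernel) (c := 54) (by decide +kernel) (w := 3) (by decide +kernel) (by decide)
    hJ hMcU hGZK hKo hrec hD36 hlev W hW hK hD3 hD4 hH hP hnt hqN hv hr hs hvs

/-- **`BSD(E,3)` for `385362l1`** (cell `(385362l1, 3)`, class X4, rank 0; JET grammar key `JETA:385362l1@3`, bucket A at `p = 3`, `E` additive at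
`3` (door `JET.bsdp_of_jetRowA3F_tam_min`, `3`-adic tower by a Frobenius witness mod `9`)); `N = 385362 = 2·3^2·79·271`, additive `I0*` at `3`,
`r_an = 0`, `#E(ℚ)_tors = 1`, `∏c = 108`, `#Ш_an = 1`, Cremona galrep: no code at this prime (`ρ̄_{E,3}` onto); `|Δ| = ∏` over `[(2, 54), (3, 6),
(79, 1), (271, 2)]` (factored Kraus criterion, every disjunct decided). The ONE carrier: carrier `q = 2` (split `I54`, `c_q = 54`, `w = ord_3 c_q =
3`; IN THE KERNEL by the `TamLocal` certificate `⟨2, 1, 1, 0, 0, 0, 0, 54, 0, 0, 54⟩`); READING binder `hJ` = K1 `JetchevDivisibilityCarrierNe`;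
displayed index line `hv : ord_3 [E(K):ℤP] ≤ 3`. Serre Prop-15 witnesses mod `3`: `(ℓ, #Ẽ(𝔽_ℓ))` = `(11, 10)` (`X² − aX + ℓ` root-free over `𝔽₃`),
`(13, 15)` (`ℓ ≡ 1`, `a ≡ 2 (mod 3)`, `9 ∤ #Ẽ`); `3`-adic tower witness `(ℓ₉, #Ẽ) = (5, 9)` (`ℓ₉ ≡ 5 (mod 9)`, `a_ℓ₉ ≡ 6 (mod 9)`). Kurihara lane
note of record: «additive p, irreducible». State of record (referee A ROUND 983, `scratchA_A_state_after_x4gh_add3_onA2R977_fold.pkl`): class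
`residue`, 1 open cell(s), register empty. Other engine-1 fields tried (`D`: `m` (`ord_3 m`)): `-191`: `m = 216` (`ord = 3`); `-215`: `m = 432`
(`ord = 3`); `-647`: `m = 432` (`ord = 3`); `-1199`: `m = 432` (`ord = 3`); `-1439`: `m = 216` (`ord = 3`); `-1463`: `m = 432` (`ord = 3`); `-1655`:
`m = 432` (`ord = 3`); `-1799`: `m = 864` (`ord = 3`). THIS UNIT'S DATUM (displayed, NOT re-computed here): DEEP FIELD `K = ℚ(√-71)` (`71` = prime):
rank-one twist `F = E^D` (`N_F = 1942609842`), point `x` on `F` by ellrank0 (saturated at the primes `< 100`), **`m = [E(K):ℤy_K] = 216`, `ord_3 m =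
3`** (`ρ = m²/4`, `L(E,1) = 2.4995487090`, `L'(F,1) = 14.916135166`, `ĥ(x) = 19.784253878`) — engine 1 j293243 = engine 2 j295990: `m = 216` EQUAL
(FAIL:p2_not_div_N, dev ≤ 2.0e-15); twist `E^D` (j293857): `N = 1942609842`, `#tors·∏c·#Ш_an = 1·108·1`, `ord_3 #Ш_an(E^D) = 0`, `ord_3 ∏c(E^D) = 3`
(BSD-consistent). CONDITIONAL on every binder; per cell; nothing booked by this file.
[cite: Jetchev2008, Thm. 1.4 and Cor. 1.5 (p. 812)] [cite: McCallumLMS1991, Cor. 5.6] [cite: Serre1972, §2.4 Prop. 15, §2.8 Prop. 19] [cite: Cremona2006, Table 1 (label 385362l1)] -/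
theorem bsdpJD_385362l1_3
    (hJ : JetchevDivisibilityCarrierNe)
    (hMcU : McCallum1991_padicValNat_card_sha_primary_add_le_of_globalDivisibility)
    (hGZK : rank_eq_analyticRank_of_analyticRank_le_one)
    (hKo : ∀ (N : ℕ) [NeZero N] (W : WeierstrassCurve ℚ) (K : Type) [Field K] [NumberField K], kolyvagin N W K)
    (hrec : ∀ (N : ℕ) [NeZero N] (W : WeierstrassCurve ℚ) (K : Type) [Field K] [NumberField K],
      heegnerPointOfConductor_one_galoisConj N W K)
    (hD36 : ∀ (N : ℕ) [NeZero N] (W : WeierstrassCurve ℚ) (K : Type) [Field K] [NumberField K],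
      phi_heegnerTau_mem_singularModuliField N W K)
    (hlev : ∀ {N : ℕ} [NeZero N], IsNewformOf.level_eq_conductorNorm (N := N))
    (W : WeierstrassCurve ℚ) (hW : W = ⟨1, -1, 1, -1810751774, -29654207096403⟩)
    {N : ℕ} [NeZero N] {K : Type} [Field K] [NumberField K] (hK : IsImaginaryQuadratic K)
    (hD3 : NumberField.discr K ≠ -3) (hD4 : NumberField.discr K ≠ -4)
    (hH : SatisfiesHeegnerHypothesis N K) {P : (W.baseChange K).toAffine.Point}
    (hP : IsHeegnerPoint N W K P) (hnt : ¬ IsOfFinAddOrder P) (hqN : 2 ∣ N)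
    (hv : padicValNat 3 (AddSubgroup.zmultiples P).index ≤ 3)
    (hr : W.analyticRank ≤ 1) {s : ℚ} (hs : shaAn W = (s : ℂ)) (hvs : padicValRat 3 s = 0) : BSDp W 3 :=
  bsdp_of_jetRowA3F_tam_min 1 (-1) 1 (-1810751774) (-29654207096403)
    (Supersingular.isGloballyMinimal_of_krausCriterion₃_factored 1 (-1) 1 (-1810751774) (-29654207096403) [(2, 54), (3, 6), (79, 1), (271, 2)] (by decide +kernel)
      (by intro t ht; fin_cases ht <;> norm_num) (by decide +kernel))
    11 13 (by norm_num) (by norm_num) (by decide) (by decide) (by decide) (by decide) (by decide +kernel) (by decide +kernel)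
    (n₁ := 10) (n₂ := 15) (by decide +kernel) (by decide +kernel) (by decide) (by decide) (by decide) (by decide)
    5 (by norm_num) (by decide) (by decide +kernel) (n₉ := 9) (by decide +kernel) (by decide) (by decide)
    2 ⟨2, 1, 1, 0, 0, 0, 0, 54, 0, 0, 54⟩ rfl (by decide +kernel) (c := 54) (by decide +kernel) (w := 3) (by decide +kernel) (by decide)
    hJ hMcU hGZK hKo hrec hD36 hlev W hW hK hD3 hD4 hH hP hnt hqN hv hr hs hvs

end Summit.BirchSwinnertonDyer.Rank1Residual.X4

end
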